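import Mathlib
import Literature.Computability.Complexity.HermitianSosRefutation
import Literature.Computability.AlgebraicComplexity.StandardFamilies

/-!
# SOS degree bounds the Łojasiewicz exponent — the easy half of the Skoda–Łojasiewicz sandwich
(line `Sketch` of crux `CertWindowQP`, stmt-ValiantsHypothesis-5640)

The converse companion of the line's named fact `skodaBrownawellDegreeBound`: if the system
`Rep(n,m)` ("`per_n = det(A₀ + ∑ x_e A_e)` identically") has a Hermitian-SOS refutation in which
every product has total degree `≤ d`, then it satisfies a Łojasiewicz inequality at infinity with
exponent `d`: `∑_μ |eqn_μ(a)|² ≥ ε (1+|a|²)^{-d}` for all points `a` of unknown-space. Proof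
(Cauchy–Schwarz on the Hermitian identity at the conjugate point, Grigoriev 2001-style): at
`(a, ā)` the identity reads `∑_j |q_j|² + 2 Re ∑_μ h_μ(a,ā) eqn_μ(a) + 1 = 0`, so
`1 ≤ 2 ∑_μ |h_μ(a,ā)| |eqn_μ(a)| ≤ 2 ‖h(a,ā)‖ ‖eqn(a)‖`; the multipliers `h_μ` attached to nonzero
axioms have degree `≤ d` (`ℂ[…]` is a domain), hence `|h_μ(a,ā)| ≤ A_μ (1+|a|²)^{d/2}`.
Together with the Skoda–Brownawell bound this shows that, modulo that analytic fact, the crux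
`CertWindowQP` is EQUIVALENT to "`Rep(n,m)` is infeasible with a polynomial Łojasiewicz exponent
throughout the quasi-polynomial window" (idea card skoda-border-sandwich, transfer C⁼). Everything
here is proved (Mathlib + `HermitianSosRefutation.lean`).
-/

noncomputable section

open scoped BigOperators ComplexConjugate
open MvPolynomial

namespace Summit.ValiantsHypothesis.ValiantsHypothesis.Theorems

open Literature.Computability.AlgebraicComplexity Literature.Computability.Complexity

section Growth

variable {κ : Type*}

/-- **Polynomial growth.** If every coordinate of `x` has norm `≤ S` with `S ≥ 1`, then
`|p(x)| ≤ (∑_μ |coeff_μ p|) · S^{deg p}`. [folklore] -/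
theorem sosToLoj_norm_eval_le (p : MvPolynomial κ ℂ) (x : κ → ℂ) {S : ℝ} (hS : 1 ≤ S)
    (hx : ∀ w, ‖x w‖ ≤ S) :
    ‖eval x p‖ ≤ (∑ μ ∈ p.support, ‖coeff μ p‖) * S ^ p.totalDegree := by
  rw [eval_eq, Finset.sum_mul]
  refine (norm_sum_le _ _).trans (Finset.sum_le_sum fun μ hμ => ?_)
  rw [norm_mul, norm_prod]
  refine mul_le_mul_of_nonneg_left ?_ (norm_nonneg _)
  have hdeg : ∑ w ∈ μ.support, μ w ≤ p.totalDegree := le_totalDegree hμ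
  calc ∏ w ∈ μ.support, ‖x w ^ μ w‖ ≤ ∏ w ∈ μ.support, S ^ μ w := by
        refine Finset.prod_le_prod (fun w _ => norm_nonneg _) fun w _ => ?_
        rw [norm_pow]
        exact pow_le_pow_left₀ (norm_nonneg _) (hx w) _
    _ = S ^ ∑ w ∈ μ.support, μ w := Finset.prod_pow_eq_pow_sum _ _ _
    _ ≤ S ^ p.totalDegree := pow_le_pow_right₀ hS hdeg

/-- The coordinates of the conjugate point `(a, ā)` have norm at most `√(1 + ∑_v |a_v|²)`.
[folklore] -/
theorem sosToLoj_norm_conjPoint_le {σ : Type*} [Fintype σ] (a : σ → ℂ) (w : σ ⊕ σ) :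
    ‖conjPoint a w‖ ≤ Real.sqrt (1 + ∑ v, ‖a v‖ ^ 2) := by
  have key : ∀ v : σ, ‖a v‖ ≤ Real.sqrt (1 + ∑ v, ‖a v‖ ^ 2) := fun v => by
    rw [← Real.sqrt_sq (norm_nonneg (a v))]
    refine Real.sqrt_le_sqrt ?_
    have : ‖a v‖ ^ 2 ≤ ∑ v, ‖a v‖ ^ 2 :=
      Finset.single_le_sum (f := fun v => ‖a v‖ ^ 2) (fun v _ => by positivity) (Finset.mem_univ v)
    linarith
  rcases w with v | v
  · simpa using key v
  · simpa [conjPoint] using key v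

end Growth

/-- The abstract statement behind `certWindowQP_lojOfSos`: for ANY `x`-polynomial `P` with
coefficients in `ℂ[σ]`, a Hermitian-SOS refutation of `μ ↦ coeff_μ P` of degree `≤ d` gives
the Łojasiewicz inequality at infinity with exponent `d` for the family of coefficients.
[folklore] -/
theorem sosToLoj_of_hasHermitianSos {σ τ : Type*} [Fintype σ] (P : MvPolynomial τ (MvPolynomial σ ℂ))
    (d : ℕ) (H : HasHermitianSosRefutationOfDegree (fun μ : τ →₀ ℕ => P.coeff μ) d) :
    ∃ ε : ℝ, 0 < ε ∧ ∀ a : σ → ℂ,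
      ε * (1 + ∑ v, ‖a v‖ ^ 2) ^ (-(d : ℝ)) ≤
        ∑ μ ∈ P.support, ‖MvPolynomial.eval a (P.coeff μ)‖ ^ 2 := by
  classical
  obtain ⟨s, k, q, h, -, hh, hsum⟩ := H
  -- multipliers attached to nonzero axioms, and their coefficient mass
  let h' : (τ →₀ ℕ) → MvPolynomial (σ ⊕ σ) ℂ := fun μ => if P.coeff μ = 0 then 0 else h μ
  let A : (τ →₀ ℕ) → ℝ := fun μ => ∑ ν ∈ (h' μ).support, ‖coeff ν (h' μ)‖
  let B : ℝ := ∑ μ ∈ s, A μ ^ 2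
  have hA : ∀ μ, 0 ≤ A μ := fun μ => Finset.sum_nonneg fun ν _ => norm_nonneg _
  have hB : 0 ≤ B := Finset.sum_nonneg fun μ _ => by positivity
  -- degrees: `deg h' μ ≤ d`
  have hdeg : ∀ μ ∈ s, (h' μ).totalDegree ≤ d := by
    intro μ hμ
    by_cases h0 : P.coeff μ = 0
    · simp [h', h0]
    · have hh' : h' μ = h μ := by simp [h', h0]
      rw [hh']
      by_cases hz : h μ = 0
      · rw [hz, totalDegree_zero]; exact Nat.zero_le _
      · have hg : rename (Sum.inl : σ → σ ⊕ σ) (P.coeff μ) ≠ 0 := by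
          intro hc
          exact h0 (rename_injective _ Sum.inl_injective (by rw [hc, map_zero]))
        have := hh μ hμ
        rw [totalDegree_mul_of_isDomain hz hg] at this
        omega
  refine ⟨1 / (4 * B + 4), by positivity, fun a => ?_⟩
  -- notation for the point
  set S : ℝ := Real.sqrt (1 + ∑ v, ‖a v‖ ^ 2) with hSdef
  have hsum0 : 0 ≤ ∑ v, ‖a v‖ ^ 2 := Finset.sum_nonneg fun v _ => sq_nonneg ‖a v‖
  have hS1 : 1 ≤ S := by
    rw [hSdef, Real.le_sqrt' one_pos, one_pow]
    linarith
  have hS2 : S ^ 2 = 1 + ∑ v, ‖a v‖ ^ 2 := by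
    rw [hSdef, Real.sq_sqrt (by positivity)]
  -- evaluate the identity at the conjugate point
  have hev := congrArg (eval (conjPoint a)) hsum
  simp only [map_add, map_sum, map_one, map_zero, map_mul, eval_conjPoint_hermConj,
    eval_conjPoint_rename_inl] at hev
  -- real parts: `∑ |q_j|² + ∑ 2 Re (h g) + 1 = 0`
  have hre := congrArg Complex.re hev
  rw [Complex.add_re, Complex.add_re, Complex.re_sum, Complex.re_sum, Complex.one_re,
    Complex.zero_re] at hre
  have hq0 : 0 ≤ ∑ j, (eval (conjPoint a) (q j) * conj (eval (conjPoint a) (q j))).re :=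
    Finset.sum_nonneg fun j _ => by
      rw [Complex.mul_conj, Complex.ofReal_re]
      exact Complex.normSq_nonneg _
  have hconj : ∀ μ, (conj (eval (conjPoint a) (h μ)) * conj (MvPolynomial.eval a (P.coeff μ))).re =
      (eval (conjPoint a) (h μ) * MvPolynomial.eval a (P.coeff μ)).re := fun μ => by
    rw [← map_mul, Complex.conj_re]
  simp only [Complex.add_re, hconj] at hre
  have hterm : ∀ μ ∈ s, -(‖eval (conjPoint a) (h' μ)‖ * ‖MvPolynomial.eval a (P.coeff μ)‖) ≤
      (eval (conjPoint a) (h μ) * MvPolynomial.eval a (P.coeff μ)).re := by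
    intro μ _
    by_cases h0 : P.coeff μ = 0
    · simp [h0, h']
    · have hh' : h' μ = h μ := by simp [h', h0]
      rw [hh', ← norm_mul, neg_le]
      exact (neg_le_abs _).trans (Complex.abs_re_le_norm _)
  -- 1 ≤ 2 ∑ |h'| |g|
  have h1 : (1 : ℝ) ≤ 2 * ∑ μ ∈ s, ‖eval (conjPoint a) (h' μ)‖ * ‖MvPolynomial.eval a (P.coeff μ)‖ := by
    have hle : ∑ μ ∈ s, (-(‖eval (conjPoint a) (h' μ)‖ * ‖MvPolynomial.eval a (P.coeff μ)‖) +
        -(‖eval (conjPoint a) (h' μ)‖ * ‖MvPolynomial.eval a (P.coeff μ)‖)) ≤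
        ∑ μ ∈ s, ((eval (conjPoint a) (h μ) * MvPolynomial.eval a (P.coeff μ)).re +
          (eval (conjPoint a) (h μ) * MvPolynomial.eval a (P.coeff μ)).re) :=
      Finset.sum_le_sum fun μ hμ => add_le_add (hterm μ hμ) (hterm μ hμ)
    have hsplit : ∑ μ ∈ s, (-(‖eval (conjPoint a) (h' μ)‖ * ‖MvPolynomial.eval a (P.coeff μ)‖) +
        -(‖eval (conjPoint a) (h' μ)‖ * ‖MvPolynomial.eval a (P.coeff μ)‖)) =
        -(2 * ∑ μ ∈ s, ‖eval (conjPoint a) (h' μ)‖ * ‖MvPolynomial.eval a (P.coeff μ)‖) := by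
      rw [two_mul, neg_add, ← Finset.sum_neg_distrib, ← Finset.sum_add_distrib]
    linarith
  -- Cauchy–Schwarz
  have hCS : (∑ μ ∈ s, ‖eval (conjPoint a) (h' μ)‖ * ‖MvPolynomial.eval a (P.coeff μ)‖) ^ 2 ≤
      (∑ μ ∈ s, ‖eval (conjPoint a) (h' μ)‖ ^ 2) * ∑ μ ∈ s, ‖MvPolynomial.eval a (P.coeff μ)‖ ^ 2 :=
    Finset.sum_mul_sq_le_sq_mul_sq _ _ _
  -- growth of the multipliers
  have hgrowth : ∑ μ ∈ s, ‖eval (conjPoint a) (h' μ)‖ ^ 2 ≤ B * (S ^ 2) ^ d := by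
    rw [show B * (S ^ 2) ^ d = ∑ μ ∈ s, A μ ^ 2 * (S ^ 2) ^ d from Finset.sum_mul _ _ _]
    refine Finset.sum_le_sum fun μ hμ => ?_
    have hle : ‖eval (conjPoint a) (h' μ)‖ ≤ A μ * S ^ d := by
      refine (sosToLoj_norm_eval_le (h' μ) (conjPoint a) hS1
        (fun w => sosToLoj_norm_conjPoint_le a w)).trans ?_
      exact mul_le_mul_of_nonneg_left (pow_le_pow_right₀ hS1 (hdeg μ hμ)) (hA μ)
    calc ‖eval (conjPoint a) (h' μ)‖ ^ 2 ≤ (A μ * S ^ d) ^ 2 :=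
          pow_le_pow_left₀ (norm_nonneg _) hle 2
      _ = A μ ^ 2 * (S ^ 2) ^ d := by ring
  -- the sum over `s` is dominated by the sum over the support
  have hsupp : ∑ μ ∈ s, ‖MvPolynomial.eval a (P.coeff μ)‖ ^ 2 ≤ ∑ μ ∈ P.support, ‖MvPolynomial.eval a (P.coeff μ)‖ ^ 2 := by
    calc ∑ μ ∈ s, ‖MvPolynomial.eval a (P.coeff μ)‖ ^ 2 = ∑ μ ∈ s ∩ P.support, ‖MvPolynomial.eval a (P.coeff μ)‖ ^ 2 := by
          symm
          refine Finset.sum_subset Finset.inter_subset_left fun μ hμs hμ => ?_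
          have h0 : P.coeff μ = 0 := by
            by_contra hne
            exact hμ (Finset.mem_inter.mpr ⟨hμs, mem_support_iff.mpr hne⟩)
          simp [h0]
      _ ≤ ∑ μ ∈ P.support, ‖MvPolynomial.eval a (P.coeff μ)‖ ^ 2 :=
          Finset.sum_le_sum_of_subset_of_nonneg Finset.inter_subset_right
            fun μ _ _ => by positivity
  -- assemble: 1 ≤ 4 · B S^{2d} · G'
  have hX : 0 ≤ ∑ μ ∈ s, ‖eval (conjPoint a) (h' μ)‖ * ‖MvPolynomial.eval a (P.coeff μ)‖ :=
    Finset.sum_nonneg fun μ _ => by positivity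
  have hX2 : (1 : ℝ) ≤ 4 * (∑ μ ∈ s, ‖eval (conjPoint a) (h' μ)‖ * ‖MvPolynomial.eval a (P.coeff μ)‖) ^ 2 := by nlinarith
  have hGs : 0 ≤ ∑ μ ∈ s, ‖MvPolynomial.eval a (P.coeff μ)‖ ^ 2 := Finset.sum_nonneg fun μ _ => by positivity
  have hprod : (∑ μ ∈ s, ‖eval (conjPoint a) (h' μ)‖ ^ 2) * ∑ μ ∈ s, ‖MvPolynomial.eval a (P.coeff μ)‖ ^ 2 ≤
      (B * (S ^ 2) ^ d) * ∑ μ ∈ P.support, ‖MvPolynomial.eval a (P.coeff μ)‖ ^ 2 :=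
    mul_le_mul hgrowth hsupp hGs (by positivity)
  have hmain : (1 : ℝ) ≤ 4 * (B * (S ^ 2) ^ d) * ∑ μ ∈ P.support, ‖MvPolynomial.eval a (P.coeff μ)‖ ^ 2 := by
    linarith
  -- conclude
  have hG : 0 ≤ ∑ μ ∈ P.support, ‖MvPolynomial.eval a (P.coeff μ)‖ ^ 2 := Finset.sum_nonneg fun μ _ => by positivity
  have hfin : (1 : ℝ) ≤ (4 * B + 4) * ((S ^ 2) ^ d * ∑ μ ∈ P.support, ‖MvPolynomial.eval a (P.coeff μ)‖ ^ 2) := by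
    have : 0 ≤ (S ^ 2) ^ d * ∑ μ ∈ P.support, ‖MvPolynomial.eval a (P.coeff μ)‖ ^ 2 := by positivity
    nlinarith
  rw [← hS2, Real.rpow_neg (by positivity), Real.rpow_natCast,
    show (1 / (4 * B + 4)) * ((S ^ 2) ^ d)⁻¹ = 1 / ((4 * B + 4) * (S ^ 2) ^ d) by
      field_simp,
    div_le_iff₀ (by positivity)]
  calc (1 : ℝ) ≤ (4 * B + 4) * ((S ^ 2) ^ d * ∑ μ ∈ P.support, ‖MvPolynomial.eval a (P.coeff μ)‖ ^ 2) := hfin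
    _ = (∑ μ ∈ P.support, ‖MvPolynomial.eval a (P.coeff μ)‖ ^ 2) * ((4 * B + 4) * (S ^ 2) ^ d) := by ring

/-- **SOS degree bounds the Łojasiewicz exponent at infinity** (easy half of the
Skoda–Łojasiewicz sandwich for `Rep(n,m)`). A Hermitian-SOS refutation of the system
`μ ↦ coeff_μ (det(A₀ + ∑ x_e A_e) - per_n)` with all products of degree `≤ d` yields `ε > 0` with
`ε (1 + ∑_v |a_v|²)^{-d} ≤ ∑_{μ ∈ supp P} |eqn_μ(a)|²` for every point `a` of unknown-space.
Proof: module docstring. -/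
theorem certWindowQP_lojOfSos (n m d : ℕ)
    (h : HasHermitianSosRefutationOfDegree (fun μ : (Fin n × Fin n) →₀ ℕ =>
      ((Matrix.of fun i j : Fin m => MvPolynomial.C (MvPolynomial.X (none, (i, j))) + ∑ e : Fin n × Fin n, MvPolynomial.X e * MvPolynomial.C (MvPolynomial.X (some e, (i, j))) : Matrix (Fin m) (Fin m) (MvPolynomial (Fin n × Fin n) (MvPolynomial (Option (Fin n × Fin n) × (Fin m × Fin m)) ℂ))).det - MvPolynomial.map MvPolynomial.C (Literature.Computability.AlgebraicComplexity.perPoly (Fin n) ℂ)).coeff μ) d) :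
    ∃ ε : ℝ, 0 < ε ∧ ∀ a : Option (Fin n × Fin n) × (Fin m × Fin m) → ℂ,
      ε * (1 + ∑ v, ‖a v‖ ^ 2) ^ (-(d : ℝ)) ≤ ∑ μ ∈ ((Matrix.of fun i j : Fin m => MvPolynomial.C (MvPolynomial.X (none, (i, j))) + ∑ e : Fin n × Fin n, MvPolynomial.X e * MvPolynomial.C (MvPolynomial.X (some e, (i, j))) : Matrix (Fin m) (Fin m) (MvPolynomial (Fin n × Fin n) (MvPolynomial (Option (Fin n × Fin n) × (Fin m × Fin m)) ℂ))).det - MvPolynomial.map MvPolynomial.C (Literature.Computability.AlgebraicComplexity.perPoly (Fin n) ℂ)).support,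
        ‖MvPolynomial.eval a (((Matrix.of fun i j : Fin m => MvPolynomial.C (MvPolynomial.X (none, (i, j))) + ∑ e : Fin n × Fin n, MvPolynomial.X e * MvPolynomial.C (MvPolynomial.X (some e, (i, j))) : Matrix (Fin m) (Fin m) (MvPolynomial (Fin n × Fin n) (MvPolynomial (Option (Fin n × Fin n) × (Fin m × Fin m)) ℂ))).det - MvPolynomial.map MvPolynomial.C (Literature.Computability.AlgebraicComplexity.perPoly (Fin n) ℂ)).coeff μ)‖ ^ 2 :=
  sosToLoj_of_hasHermitianSos _ d h

/-- **Stub `stub_sosToLoj`** (sub-goal registered by the lead for line `Sketch`, crux `CertWindowQP`):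
the easy half of the sandwich, verbatim signature; proved by `certWindowQP_lojOfSos`. -/
theorem stub_sosToLoj (n m d : ℕ)
    (h : HasHermitianSosRefutationOfDegree (fun μ : (Fin n × Fin n) →₀ ℕ =>
      ((Matrix.of fun i j : Fin m => MvPolynomial.C (MvPolynomial.X (none, (i, j))) + ∑ e : Fin n × Fin n, MvPolynomial.X e * MvPolynomial.C (MvPolynomial.X (some e, (i, j))) : Matrix (Fin m) (Fin m) (MvPolynomial (Fin n × Fin n) (MvPolynomial (Option (Fin n × Fin n) × (Fin m × Fin m)) ℂ))).det - MvPolynomial.map MvPolynomial.C (Literature.Computability.AlgebraicComplexity.perPoly (Fin n) ℂ)).coeff μ) d) :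
    ∃ ε : ℝ, 0 < ε ∧ ∀ a : Option (Fin n × Fin n) × (Fin m × Fin m) → ℂ,
      ε * (1 + ∑ v, ‖a v‖ ^ 2) ^ (-(d : ℝ)) ≤ ∑ μ ∈ ((Matrix.of fun i j : Fin m => MvPolynomial.C (MvPolynomial.X (none, (i, j))) + ∑ e : Fin n × Fin n, MvPolynomial.X e * MvPolynomial.C (MvPolynomial.X (some e, (i, j))) : Matrix (Fin m) (Fin m) (MvPolynomial (Fin n × Fin n) (MvPolynomial (Option (Fin n × Fin n) × (Fin m × Fin m)) ℂ))).det - MvPolynomial.map MvPolynomial.C (Literature.Computability.AlgebraicComplexity.perPoly (Fin n) ℂ)).support,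
        ‖MvPolynomial.eval a (((Matrix.of fun i j : Fin m => MvPolynomial.C (MvPolynomial.X (none, (i, j))) + ∑ e : Fin n × Fin n, MvPolynomial.X e * MvPolynomial.C (MvPolynomial.X (some e, (i, j))) : Matrix (Fin m) (Fin m) (MvPolynomial (Fin n × Fin n) (MvPolynomial (Option (Fin n × Fin n) × (Fin m × Fin m)) ℂ))).det - MvPolynomial.map MvPolynomial.C (Literature.Computability.AlgebraicComplexity.perPoly (Fin n) ℂ)).coeff μ)‖ ^ 2 :=
  certWindowQP_lojOfSos n m d h

end Summit.ValiantsHypothesis.ValiantsHypothesis.Theorems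

end
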